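import Literature.IUT.HodgeArakelov.ThetaSettingModelTateNotNormallyTerminal
import Literature.AnabelianGeometry.SemiGraphs.TemperedAnabelian
import HarnessLib

/-!
# The `Δ`-level twin: the typed [SemiAnbd] Lem. 6.1 (ii) `DeltaTempNormallyTerminal` FAILS at the stage-2 («Tate shear») model
# (`N_{Δ_X}(Δ^tp_X) = Δ_X ⊋ Δ^tp_X`; proof-only companion of abc-iut-L6-d2's `ThetaSettingModelTateNotNormallyTerminal`)

S. Mochizuki, *Semi-graphs of anabelioids*, Publ. RIMS **42** (2006) [SemiAnbd], Lem. 6.1 (ii) p. 69 («`N_{Δ_X}(Δ^temp_X) = Δ^temp_X`»,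
print: [André] Cor. 6.2.2), Lem. 6.1 (iii) p. 69 [cite: MochizukiSemiAnbd2006, Lem 6.1(ii) p.69]; S. Mochizuki, *Inter-universal Teichmüller
theory II*, §1 Rmk. 1.4.1 (ii) (kurims p. 28: «the unique order two `Δ^tp_{X̲̲_k}`-OUTER automorphism») [claim: Mochizuki2012, status: disputed]
(IUTchII §1 Rmk 1.4.1 (ii), kurims p.28).  Cell `abc-iut`, K-L6 slice, input BY NAME for row R5-5 «MODEL-NT AUDIT» (holder abc-iut-L6-d2 g9)
and the census label §F v1.19du (A4); seat abc-iut-w6-d055 (gen 9).  PROOF-ONLY: no definition, no instance, no named fact; nothing of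
abc-iut-L6-d2's file restated — its `inl_not_mem_range_toHatχq` and abc-iut-L6-d2's `exists_profiniteInner` / `right_eq_of_toHat_eq` /
`exists_exoticDatum` (p494839 / p494727) are consumed BY NAME.

WHY A TWIN.  abc-iut-L6-d2's `not_piTempNormallyTerminal_curveχq` is the `Π`-level statement (Lem. 6.1 (iii)); print's Rmk. 1.4.1 (ii)
uniqueness is a `Δ^tp`-OUTER statement whose print route ([SemiAnbd] Thm. 6.4/6.6 via Lem. 6.1 (ii)) uses the `Δ`-level normal terminality.
At the model BOTH fail, for the same reason: `Δ_X = inl F̂₂` normalises the image `inl ê⁻¹(ι ℤ)` of `Δ^tp_X` (the profinite-inner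
automorphisms are over `G_{ℚ_p}`, so they carry `Δ^tp_X = Ker(aug)` to itself), while `inl A ∉` image for `ê(A) ∉ ι(ℤ)`.
TREE CONSUMER of the `Δ`-level predicate: abc-iut-L3's [SemiAnbd] Thm. 6.6 route
`TemperedCurve.profiniteOuterIsoLifts_of_system_of_deltaTempNormallyTerminal` (binder `hii : Y.DeltaTempNormallyTerminal`; also
`profiniteNormalizers_of_deltaTempNormallyTerminal`) — at `Y := curveχq p i j` that binder is UNSATISFIABLE by this file.
RESULTS (every prime `p`, every `(i, j)`): `conj_inl_mem_map_deltaTemp_toHatχq`; ★ `not_deltaTempNormallyTerminal_curveχq`;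
`not_deltaTempNormallyTerminal_modelχq`; and the two GENERIC certificates over the interface `TemperedCurve p` —
`TemperedCurve.not_piTempNormallyTerminal_of_normal_of_ne_top`, `TemperedCurve.not_deltaTempNormallyTerminal_of_normal_of_ne_top`
(ANY inhabitant whose tempered image is normal and proper in the relevant completion fails Lem. 6.1 (iii) / (ii) — in particular every
«`Ẑ`-preimage» model `ê⁻¹(ℤ) ⋊ G ≤ F̂ ⋊ G`).

HONEST FRAMING: statements about OUR semi-synthetic model and OUR typing of [SemiAnbd] Lem. 6.1 (print's tempered groups ARE normally
terminal; census (A4): «MODEL ARTEFACT»); refuted-at-a-model ≠ refuted-in-print; no side on [IUTchIII] Cor. 3.12; typed ≠ proved.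
-/

noncomputable section

namespace Literature.AnabelianGeometry.SemiGraphs.TemperedCurve

variable {p : ℕ} [Fact p.Prime]

/-- **Generic certificate (`Π`-level).** An inhabitant of the interface whose tempered image `Π^temp ≤ Π` is a NORMAL and PROPER subgroup
of the completion is NOT normally terminal (`N_Π(Π^temp) = Π ≠ Π^temp`): the typed [SemiAnbd] Lem. 6.1 (iii) fails for it.
[cite: MochizukiSemiAnbd2006, Lem 6.1(iii) p.69] -/
theorem not_piTempNormallyTerminal_of_normal_of_ne_top (X : TemperedCurve p) (hN : X.toHat.toMonoidHom.range.Normal)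
    (hne : X.toHat.toMonoidHom.range ≠ ⊤) : ¬ X.PiTempNormallyTerminal := by
  intro h
  change Subgroup.normalizer (X.toHat.toMonoidHom.range : Set X.PiHat) = X.toHat.toMonoidHom.range at h
  rw [Subgroup.normalizer_eq_top_iff.2 hN] at h
  exact hne h.symm

/-- **Generic certificate (`Δ`-level).** If the image of `Δ^temp_X` inside `Δ_X` is a NORMAL and PROPER subgroup of `Δ_X`, then
`N_{Δ_X}(Δ^temp_X) = Δ_X ≠ Δ^temp_X`: the typed [SemiAnbd] Lem. 6.1 (ii) fails. [cite: MochizukiSemiAnbd2006, Lem 6.1(ii) p.69] -/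
theorem not_deltaTempNormallyTerminal_of_normal_of_ne_top (X : TemperedCurve p)
    (hN : ((X.DeltaTemp.map X.toHat.toMonoidHom).subgroupOf X.DeltaHat).Normal)
    (hne : (X.DeltaTemp.map X.toHat.toMonoidHom).subgroupOf X.DeltaHat ≠ ⊤) : ¬ X.DeltaTempNormallyTerminal := by
  intro h
  change Subgroup.normalizer (((X.DeltaTemp.map X.toHat.toMonoidHom).subgroupOf X.DeltaHat : Subgroup X.DeltaHat) :
      Set X.DeltaHat) = (X.DeltaTemp.map X.toHat.toMonoidHom).subgroupOf X.DeltaHat at h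
  rw [Subgroup.normalizer_eq_top_iff.2 hN] at h
  exact hne h.symm

end Literature.AnabelianGeometry.SemiGraphs.TemperedCurve

namespace Literature.AnabelianGeometry.EtaleTheta.SettingModel

open Literature.AnabelianGeometry.SemiGraphs
open Function

variable (p : ℕ) [Fact p.Prime] (i j : ℤ)

/-- The image of `Δ^tp_X` in `Π_X` is normalised by every `inl A`, `A ∈ F̂₂`: abc-iut-L6-d2's profinite-inner automorphism `Ad(A)|_{Π^tp_X}`
is over `G_{ℚ_p}` (`right_eq_of_toHat_eq`), so it carries `Δ^tp_X = Ker(aug)` to itself. [cite: MochizukiSemiAnbd2006, Lem 6.1(ii) p.69] -/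
theorem conj_inl_mem_map_deltaTemp_toHatχq (A : F₂hatT) {h : PiHtχq p i j}
    (hh : h ∈ (curveχq p i j).DeltaTemp.map (toHatχq p i j).toMonoidHom) :
    SemidirectProduct.inl A * h * (SemidirectProduct.inl A)⁻¹ ∈ (curveχq p i j).DeltaTemp.map (toHatχq p i j).toMonoidHom := by
  obtain ⟨x, hx, rfl⟩ := hh
  obtain ⟨φ, hφ⟩ := exists_profiniteInner p i j A
  refine ⟨φ x, ?_, hφ x⟩
  change (φ x).right = 1
  rw [right_eq_of_toHat_eq hφ x]
  exact hx

/-- ★ **The typed [SemiAnbd] Lem. 6.1 (ii) FAILS at the stage-2 model, for every `p`, `i`, `j`: `¬ (curveχq p i j).DeltaTempNormallyTerminal`**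
— `N_{Δ_X}(Δ^tp_X) = Δ_X ⊋ Δ^tp_X`: `Δ_X = Ker(Π_X → G) = inl F̂₂` normalises the image of `Δ^tp_X` (`conj_inl_mem_map_deltaTemp_toHatχq`),
and abc-iut-L6-d2's exotic `inl A` (`ê(A) ∉ ι(ℤ)`) lies in `Δ_X` but not in the image of `Π^tp_X` (`inl_not_mem_range_toHatχq`).
The `Δ`-level form relevant to «`Δ^tp`-outer» uniqueness statements (Rmk. 1.4.1 (ii)). [cite: MochizukiSemiAnbd2006, Lem 6.1(ii) p.69] -/
theorem not_deltaTempNormallyTerminal_curveχq : ¬ (curveχq p i j).DeltaTempNormallyTerminal := by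
  -- `Δ_X = Ker(Π_X → G_{ℚ_p})`: membership is `g.right = 1`
  have hmemΔ : ∀ g : PiHtχq p i j, g ∈ (curveχq p i j).DeltaHat ↔ g.right = 1 := fun g => by
    rw [deltaHatχq_eq]; exact Iff.rfl
  refine (curveχq p i j).not_deltaTempNormallyTerminal_of_normal_of_ne_top ?_ ?_
  · -- (1) the image of `Δ^tp_X` is normal in `Δ_X = inl F̂₂`
    refine ⟨fun h hh g => ?_⟩
    rw [Subgroup.mem_subgroupOf] at hh ⊢
    have hg1 : (g : PiHtχq p i j).right = 1 := (hmemΔ g).mp g.2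
    have hg : (g : PiHtχq p i j) = SemidirectProduct.inl (g : PiHtχq p i j).left := by
      rw [← SemidirectProduct.inl_left_mul_inr_right (g : PiHtχq p i j), hg1, map_one, mul_one,
        SemidirectProduct.left_inl]
    change (g : PiHtχq p i j) * h * (g : PiHtχq p i j)⁻¹ ∈ _
    rw [hg]
    exact conj_inl_mem_map_deltaTemp_toHatχq p i j _ hh
  · -- (2) the exotic `inl A` lies in `Δ_X` but not in the image of `Π^tp_X`
    obtain ⟨A, -, -, hA⟩ := exists_exoticDatum (1 : ℕ+)
    have hAΔ : (SemidirectProduct.inl A : PiHtχq p i j) ∈ (curveχq p i j).DeltaHat :=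
      (hmemΔ _).mpr (SemidirectProduct.right_inl A)
    intro h
    have hmem : (⟨SemidirectProduct.inl A, hAΔ⟩ : (curveχq p i j).DeltaHat) ∈
        ((curveχq p i j).DeltaTemp.map (curveχq p i j).toHat.toMonoidHom).subgroupOf (curveχq p i j).DeltaHat :=
      h ▸ Subgroup.mem_top _
    rw [Subgroup.mem_subgroupOf] at hmem
    obtain ⟨x, -, hx⟩ := hmem
    exact inl_not_mem_range_toHatχq p i j hA ⟨x, hx⟩

/-- The same at the named theta settings `ThetaSetting.modelχq p i j hj`. [cite: MochizukiSemiAnbd2006, Lem 6.1(ii) p.69] -/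
theorem not_deltaTempNormallyTerminal_modelχq (hj : Even j) :
    ¬ (ThetaSetting.modelχq p i j hj).toTemperedCurve.DeltaTempNormallyTerminal := not_deltaTempNormallyTerminal_curveχq p i j

end Literature.AnabelianGeometry.EtaleTheta.SettingModel

end
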